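import Summits.CriticalPhenomena.SAWScalingLimit.Theorems.SAWTotalPositivityBoundaryTP2Defs
import Summits.CriticalPhenomena.SAWScalingLimit.Theorems.SAWTotalPositivityBoundaryTP2Kernel
import Summits.CriticalPhenomena.SAWScalingLimit.Theorems.SAWTotalPositivityBoundaryTP2LadderKernelsInterior
import Summits.CriticalPhenomena.SAWScalingLimit.Theorems.EdgeOfPositivity.Negative.EdgeOfPositivityRectDomain
import HarnessLib

/-!
# Crux `BoundaryTP2` (stmt-CriticalPhenomena-7115), line `Sketch`: bottom row of the ladders,
crossing pairing vs adjacent pairing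

Tool stub `stub_ladder_bottomRow_adjacent` of the line's skeleton: on the ladder
`R_L = discreteDomainGraph (rectDomain L 1) 1` (sites `{0..L} × {0,1}`), for bottom sites
`c₁ < c₂ < c₃ < c₄ ≤ L` and `0 ≤ x ≤ 1/2`, the crossing pairing weighs at most the adjacent one:
`Z₁₃ Z₂₄ ≤ Z₁₂ Z₃₄`.

Proof. By `stub_ladderKernels_interior` the bottom-row kernels have the rank-two form
`Z(i,j) = x^n/2 · (a_i b_j P^{n-1} + a'_i b'_j M^{n-1})`, `n = j - i`, `P = 1+x`, `M = 1-x`,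
`a_i = P + E_i`, `a'_i = M - E_i`, `b_j = P + E_{L-j}`, `b'_j = M - E_{L-j}`,
`E_k = Σ_{d<k} x^{2d+3}` (`ladderAdj_kernel`). Since `E_k (1-x²) ≤ x³`, `0 ≤ E_k ≤ 1/6` on
`[0, 1/2]`, so every bracket `B = a b P^k + a' b' M^k` satisfies `a b P^k ≤ B` and
`B P² ≤ a b P^k (P² + M²)` (from `a' P ≤ a M`, `b' P ≤ b M`, `M^k ≤ P^k`). Bounding the two crossing
kernels above and the two adjacent kernels below, the claim reduces to
`(xP)^{2m+2} (P²+M²)² a₂ b₃ ≤ P⁴ a₃ b₂` (`m + 1 = c₃ - c₂`), which follows from `a₂ ≤ a₃`,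
`b₃ ≤ b₂` (`E_k` is monotone in `k`) and `(xP)^{2m+2} (P²+M²)² ≤ (xP)² (P²+M²)² ≤ P⁴`, i.e.
`x (1+x) (2 + 2x²) ≤ (1+x)²` on `[0, 1/2]`.
-/

noncomputable section

namespace Summit.CriticalPhenomena.SAWScalingLimit.Theorems.BoundaryTP2

open Literature.Probability.LatticeModels Literature.Probability.RandomPlanarGeometry
open Summit.CriticalPhenomena.SAWScalingLimit.Theorems.EdgeOfPositivity.Negative
open scoped ENNReal

/-! ## The excursion sums `E_k = Σ_{d<k} x^{2d+3}` -/

/-- `E_k ≥ 0` for `x ≥ 0`. [folklore] -/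
private theorem ladderAdj_E_nonneg {x : ℝ} (hx : 0 ≤ x) (k : ℕ) :
    0 ≤ ∑ d ∈ Finset.range k, x ^ (2 * d + 3) :=
  Finset.sum_nonneg fun _ _ => pow_nonneg hx _

/-- Telescoping: `E_k (1 - x²) + x^{2k+3} = x³`. [folklore] -/
private theorem ladderAdj_E_telescope (x : ℝ) (k : ℕ) :
    (∑ d ∈ Finset.range k, x ^ (2 * d + 3)) * (1 - x ^ 2) + x ^ (2 * k + 3) = x ^ 3 := by
  induction k with
  | zero => simp
  | succ k ih =>
    rw [Finset.sum_range_succ]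
    linear_combination ih

/-- Powers of `x ∈ [0, 1/2]` are at most the powers of `1/2`. [folklore] -/
private theorem ladderAdj_pow_le {x : ℝ} (hx0 : 0 ≤ x) (hx : x ≤ 1 / 2) (n : ℕ) :
    x ^ n ≤ (1 / 2) ^ n :=
  pow_le_pow_left₀ hx0 hx n

/-- `E_k ≤ 1/6` for `0 ≤ x ≤ 1/2` (from `E_k (1 - x²) ≤ x³ ≤ 1/8` and `1 - x² ≥ 3/4`).
[folklore] -/
private theorem ladderAdj_E_le {x : ℝ} (hx0 : 0 ≤ x) (hx : x ≤ 1 / 2) (k : ℕ) :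
    ∑ d ∈ Finset.range k, x ^ (2 * d + 3) ≤ 1 / 6 := by
  have h := ladderAdj_E_telescope x k
  have hE := ladderAdj_E_nonneg hx0 k
  have hk : 0 ≤ x ^ (2 * k + 3) := pow_nonneg hx0 _
  have hx2 := ladderAdj_pow_le hx0 hx 2
  have hx3 := ladderAdj_pow_le hx0 hx 3
  norm_num at hx2 hx3
  nlinarith [mul_nonneg hE (by linarith : (0 : ℝ) ≤ 1 / 4 - x ^ 2)]

/-- `E_k` is monotone in `k` for `x ≥ 0`. [folklore] -/
private theorem ladderAdj_E_mono {x : ℝ} (hx : 0 ≤ x) {k l : ℕ} (hkl : k ≤ l) :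
    ∑ d ∈ Finset.range k, x ^ (2 * d + 3) ≤ ∑ d ∈ Finset.range l, x ^ (2 * d + 3) :=
  Finset.sum_le_sum_of_subset_of_nonneg (Finset.range_mono hkl) fun _ _ _ => pow_nonneg hx _

/-! ## The rank-two form of the bottom-row kernels -/

/-- Bottom-row kernels of the ladder `{0..L}×{0,1}` in rank-two form: for `i + n + 1 = j ≤ L` and
`x ≥ 0`, `Z_{R_L}((i,0),(j,0)) = x^{n+1}/2 · (a_i b_j (1+x)^n + a'_i b'_j (1-x)^n)` with
`a_i = 1+x+E_i`, `a'_i = 1-x-E_i`, `b_j = 1+x+E_{L-j}`, `b'_j = 1-x-E_{L-j}` (a regrouping of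
`stub_ladderKernels_interior`). [folklore] -/
private theorem ladderAdj_kernel (L i j n : ℕ) (hn : i + n + 1 = j) (hjL : j ≤ L) {x : ℝ}
    (hx : 0 ≤ x) :
    pathKernel (discreteDomainGraph (rectDomain L 1) 1) x (st i 0) (st j 0) =
      ENNReal.ofReal (x ^ (n + 1) / 2 *
        ((1 + x + ∑ d ∈ Finset.range i, x ^ (2 * d + 3)) *
              (1 + x + ∑ d ∈ Finset.range (L - j), x ^ (2 * d + 3)) * (1 + x) ^ n +
          (1 - x - ∑ d ∈ Finset.range i, x ^ (2 * d + 3)) *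
              (1 - x - ∑ d ∈ Finset.range (L - j), x ^ (2 * d + 3)) * (1 - x) ^ n)) := by
  rw [stub_ladderKernels_interior L i j (by omega) hjL hx 0 0 (Or.inl rfl) (Or.inl rfl),
    if_pos rfl]
  congr 1
  subst hn
  have e1 : i + n + 1 - i = n + 1 := by omega
  have e2 : n + 1 - 1 = n := rfl
  rw [e1, e2]
  ring

/-! ## Real inequalities in the rank-two variables -/

/-- The main part `a b (1+x)^k` of a bracket is nonnegative. [folklore] -/
private theorem ladderAdj_main_nonneg {x e f : ℝ} (k : ℕ) (hx0 : 0 ≤ x) (he : 0 ≤ e)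
    (hf : 0 ≤ f) : 0 ≤ (1 + x + e) * (1 + x + f) * (1 + x) ^ k := by
  positivity

/-- Lower bound of a bracket: `a b P^k ≤ a b P^k + a' b' M^k` (`a', b', M ≥ 0` for `x ≤ 1/2`,
`e, f ≤ 1/6`). [folklore] -/
private theorem ladderAdj_bracket_lower {x e f : ℝ} (k : ℕ) (hx : x ≤ 1 / 2) (he : e ≤ 1 / 6)
    (hf : f ≤ 1 / 6) :
    (1 + x + e) * (1 + x + f) * (1 + x) ^ k ≤
      (1 + x + e) * (1 + x + f) * (1 + x) ^ k + (1 - x - e) * (1 - x - f) * (1 - x) ^ k :=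
  le_add_of_nonneg_right
    (mul_nonneg (mul_nonneg (by linarith) (by linarith)) (pow_nonneg (by linarith) k))

/-- A bracket is nonnegative. [folklore] -/
private theorem ladderAdj_bracket_nonneg {x e f : ℝ} (k : ℕ) (hx0 : 0 ≤ x) (hx : x ≤ 1 / 2)
    (he0 : 0 ≤ e) (he : e ≤ 1 / 6) (hf0 : 0 ≤ f) (hf : f ≤ 1 / 6) :
    0 ≤ (1 + x + e) * (1 + x + f) * (1 + x) ^ k + (1 - x - e) * (1 - x - f) * (1 - x) ^ k :=
  (ladderAdj_main_nonneg k hx0 he0 hf0).trans (ladderAdj_bracket_lower k hx he hf)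

/-- The rank-two form of a kernel is nonnegative. [folklore] -/
private theorem ladderAdj_form_nonneg {x e f : ℝ} (k : ℕ) (hx0 : 0 ≤ x) (hx : x ≤ 1 / 2)
    (he0 : 0 ≤ e) (he : e ≤ 1 / 6) (hf0 : 0 ≤ f) (hf : f ≤ 1 / 6) :
    0 ≤ x ^ (k + 1) / 2 *
      ((1 + x + e) * (1 + x + f) * (1 + x) ^ k + (1 - x - e) * (1 - x - f) * (1 - x) ^ k) :=
  mul_nonneg (by positivity) (ladderAdj_bracket_nonneg k hx0 hx he0 he hf0 hf)

/-- Upper bound of a bracket: `(a b P^k + a' b' M^k) P² ≤ a b P^k (P² + M²)`, from `a' P ≤ a M`,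
`b' P ≤ b M` and `M^k ≤ P^k`. [folklore] -/
private theorem ladderAdj_bracket_upper {x e f : ℝ} (k : ℕ) (hx0 : 0 ≤ x) (hx : x ≤ 1 / 2)
    (he0 : 0 ≤ e) (hf0 : 0 ≤ f) (hf : f ≤ 1 / 6) :
    ((1 + x + e) * (1 + x + f) * (1 + x) ^ k + (1 - x - e) * (1 - x - f) * (1 - x) ^ k) *
        (1 + x) ^ 2 ≤
      (1 + x + e) * (1 + x + f) * (1 + x) ^ k * ((1 + x) ^ 2 + (1 - x) ^ 2) := by
  have h1 : (1 - x - e) * (1 + x) ≤ (1 + x + e) * (1 - x) := by nlinarith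
  have h2 : (1 - x - f) * (1 + x) ≤ (1 + x + f) * (1 - x) := by nlinarith
  have h3 : (1 - x) ^ k ≤ (1 + x) ^ k := pow_le_pow_left₀ (by linarith) (by linarith) k
  have key : (1 - x - e) * (1 + x) * ((1 - x - f) * (1 + x)) * (1 - x) ^ k ≤
      (1 + x + e) * (1 - x) * ((1 + x + f) * (1 - x)) * (1 + x) ^ k :=
    mul_le_mul (mul_le_mul h1 h2 (mul_nonneg (by linarith) (by linarith))
      (mul_nonneg (by linarith) (by linarith))) h3 (pow_nonneg (by linarith) k)
      (mul_nonneg (mul_nonneg (by linarith) (by linarith)) (mul_nonneg (by linarith) (by linarith)))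
  nlinarith [key]

/-- The scalar inequality `x^{2m+2} (1+x)^{2m+2} ((1+x)² + (1-x)²)² ≤ (1+x)⁴` on `[0, 1/2]`.
[folklore] -/
private theorem ladderAdj_scalar {x : ℝ} (m : ℕ) (hx0 : 0 ≤ x) (hx : x ≤ 1 / 2) :
    x ^ (2 * m + 2) * (1 + x) ^ (2 * m + 2) * ((1 + x) ^ 2 + (1 - x) ^ 2) ^ 2 ≤ (1 + x) ^ 4 := by
  rw [← mul_pow]
  have hx2 := ladderAdj_pow_le hx0 hx 2
  have hx3 := ladderAdj_pow_le hx0 hx 3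
  have hx4 := ladderAdj_pow_le hx0 hx 4
  norm_num at hx2 hx3 hx4
  have h0 : 0 ≤ x * (1 + x) := mul_nonneg hx0 (by linarith)
  have h1 : x * (1 + x) ≤ 1 := by nlinarith
  have hpow : (x * (1 + x)) ^ (2 * m + 2) ≤ (x * (1 + x)) ^ 2 :=
    pow_le_pow_of_le_one h0 h1 (by omega)
  have hlin : x * (1 + x) * ((1 + x) ^ 2 + (1 - x) ^ 2) ≤ (1 + x) ^ 2 := by nlinarith
  have hnn : 0 ≤ x * (1 + x) * ((1 + x) ^ 2 + (1 - x) ^ 2) := mul_nonneg h0 (by positivity)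
  calc (x * (1 + x)) ^ (2 * m + 2) * ((1 + x) ^ 2 + (1 - x) ^ 2) ^ 2
      ≤ (x * (1 + x)) ^ 2 * ((1 + x) ^ 2 + (1 - x) ^ 2) ^ 2 :=
        mul_le_mul_of_nonneg_right hpow (by positivity)
    _ = (x * (1 + x) * ((1 + x) ^ 2 + (1 - x) ^ 2)) ^ 2 := by ring
    _ ≤ ((1 + x) ^ 2) ^ 2 := pow_le_pow_left₀ hnn hlin 2
    _ = (1 + x) ^ 4 := by ring

/-- The real inequality behind `stub_ladder_bottomRow_adjacent`, in the rank-two variables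
`e₁ = E_{c₁}`, `e₂ = E_{c₂}`, `e₃ = E_{c₃}`, `f₂ = E_{L-c₂}`, `f₃ = E_{L-c₃}`, `f₄ = E_{L-c₄}`,
spans `c₂ - c₁ = u+1`, `c₃ - c₂ = m+1`, `c₄ - c₃ = w+1`. [folklore] -/
private theorem ladderAdj_real {x e₁ e₂ e₃ f₂ f₃ f₄ : ℝ} (u m w : ℕ) (hx0 : 0 ≤ x)
    (hx : x ≤ 1 / 2) (he₁ : 0 ≤ e₁) (he₁' : e₁ ≤ 1 / 6) (he₂ : 0 ≤ e₂) (he₂' : e₂ ≤ 1 / 6)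
    (he₃ : 0 ≤ e₃) (he₃' : e₃ ≤ 1 / 6) (hf₂ : 0 ≤ f₂) (hf₂' : f₂ ≤ 1 / 6) (hf₃ : 0 ≤ f₃)
    (hf₃' : f₃ ≤ 1 / 6) (hf₄ : 0 ≤ f₄) (hf₄' : f₄ ≤ 1 / 6) (h₂₃ : e₂ ≤ e₃) (h₃₂ : f₃ ≤ f₂) :
    x ^ (u + m + 1 + 1) / 2 *
          ((1 + x + e₁) * (1 + x + f₃) * (1 + x) ^ (u + m + 1) +
            (1 - x - e₁) * (1 - x - f₃) * (1 - x) ^ (u + m + 1)) *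
        (x ^ (m + w + 1 + 1) / 2 *
          ((1 + x + e₂) * (1 + x + f₄) * (1 + x) ^ (m + w + 1) +
            (1 - x - e₂) * (1 - x - f₄) * (1 - x) ^ (m + w + 1))) ≤
      x ^ (u + 1) / 2 *
          ((1 + x + e₁) * (1 + x + f₂) * (1 + x) ^ u + (1 - x - e₁) * (1 - x - f₂) * (1 - x) ^ u) *
        (x ^ (w + 1) / 2 *
          ((1 + x + e₃) * (1 + x + f₄) * (1 + x) ^ w +
            (1 - x - e₃) * (1 - x - f₄) * (1 - x) ^ w)) := by
  have hP : 0 ≤ 1 + x := by linarith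
  have hP4 : 0 < (1 + x) ^ 4 := by positivity
  -- the two crossing brackets from above, the two adjacent brackets from below
  have U13 := ladderAdj_bracket_upper (u + m + 1) hx0 hx he₁ hf₃ hf₃'
  have U24 := ladderAdj_bracket_upper (m + w + 1) hx0 hx he₂ hf₄ hf₄'
  have L12 := ladderAdj_bracket_lower u hx he₁' hf₂'
  have L34 := ladderAdj_bracket_lower w hx he₃' hf₄'
  have B24 := ladderAdj_bracket_nonneg (m + w + 1) hx0 hx he₂ he₂' hf₄ hf₄'
  have B12 := ladderAdj_bracket_nonneg u hx0 hx he₁ he₁' hf₂ hf₂'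
  have A13 := ladderAdj_main_nonneg (u + m + 1) hx0 he₁ hf₃
  have A34 := ladderAdj_main_nonneg w hx0 he₃ hf₄
  -- the key comparison of the middle factors
  have hab : (1 + x + e₂) * (1 + x + f₃) ≤ (1 + x + e₃) * (1 + x + f₂) :=
    mul_le_mul (by linarith) (by linarith) (by linarith) (by linarith)
  have key : x ^ (2 * m + 2) * (1 + x) ^ (2 * m + 2) * ((1 + x) ^ 2 + (1 - x) ^ 2) ^ 2 *
        ((1 + x + e₂) * (1 + x + f₃)) ≤ (1 + x) ^ 4 * ((1 + x + e₃) * (1 + x + f₂)) :=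
    mul_le_mul (ladderAdj_scalar m hx0 hx) hab (by positivity) (by positivity)
  refine le_of_mul_le_mul_right ?_ hP4
  calc x ^ (u + m + 1 + 1) / 2 *
          ((1 + x + e₁) * (1 + x + f₃) * (1 + x) ^ (u + m + 1) +
            (1 - x - e₁) * (1 - x - f₃) * (1 - x) ^ (u + m + 1)) *
        (x ^ (m + w + 1 + 1) / 2 *
          ((1 + x + e₂) * (1 + x + f₄) * (1 + x) ^ (m + w + 1) +
            (1 - x - e₂) * (1 - x - f₄) * (1 - x) ^ (m + w + 1))) * (1 + x) ^ 4
      = x ^ (u + m + 1 + 1) / 2 * (x ^ (m + w + 1 + 1) / 2) *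
          (((1 + x + e₁) * (1 + x + f₃) * (1 + x) ^ (u + m + 1) +
              (1 - x - e₁) * (1 - x - f₃) * (1 - x) ^ (u + m + 1)) * (1 + x) ^ 2 *
            (((1 + x + e₂) * (1 + x + f₄) * (1 + x) ^ (m + w + 1) +
              (1 - x - e₂) * (1 - x - f₄) * (1 - x) ^ (m + w + 1)) * (1 + x) ^ 2)) := by ring
    _ ≤ x ^ (u + m + 1 + 1) / 2 * (x ^ (m + w + 1 + 1) / 2) *
          ((1 + x + e₁) * (1 + x + f₃) * (1 + x) ^ (u + m + 1) * ((1 + x) ^ 2 + (1 - x) ^ 2) *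
            ((1 + x + e₂) * (1 + x + f₄) * (1 + x) ^ (m + w + 1) *
              ((1 + x) ^ 2 + (1 - x) ^ 2))) :=
        mul_le_mul_of_nonneg_left
          (mul_le_mul U13 U24 (mul_nonneg B24 (pow_nonneg hP 2)) (mul_nonneg A13 (by positivity)))
          (by positivity)
    _ = x ^ (u + 1) * x ^ (w + 1) / 4 * ((1 + x + e₁) * (1 + x + f₄)) * (1 + x) ^ (u + w) *
          (x ^ (2 * m + 2) * (1 + x) ^ (2 * m + 2) * ((1 + x) ^ 2 + (1 - x) ^ 2) ^ 2 *
            ((1 + x + e₂) * (1 + x + f₃))) := by ring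
    _ ≤ x ^ (u + 1) * x ^ (w + 1) / 4 * ((1 + x + e₁) * (1 + x + f₄)) * (1 + x) ^ (u + w) *
          ((1 + x) ^ 4 * ((1 + x + e₃) * (1 + x + f₂))) :=
        mul_le_mul_of_nonneg_left key (by positivity)
    _ = x ^ (u + 1) / 2 * (x ^ (w + 1) / 2) *
          ((1 + x + e₁) * (1 + x + f₂) * (1 + x) ^ u *
            ((1 + x + e₃) * (1 + x + f₄) * (1 + x) ^ w)) * (1 + x) ^ 4 := by ring
    _ ≤ x ^ (u + 1) / 2 * (x ^ (w + 1) / 2) *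
          (((1 + x + e₁) * (1 + x + f₂) * (1 + x) ^ u +
              (1 - x - e₁) * (1 - x - f₂) * (1 - x) ^ u) *
            ((1 + x + e₃) * (1 + x + f₄) * (1 + x) ^ w +
              (1 - x - e₃) * (1 - x - f₄) * (1 - x) ^ w)) * (1 + x) ^ 4 :=
        mul_le_mul_of_nonneg_right
          (mul_le_mul_of_nonneg_left (mul_le_mul L12 L34 A34 B12) (by positivity)) hP4.le
    _ = x ^ (u + 1) / 2 *
          ((1 + x + e₁) * (1 + x + f₂) * (1 + x) ^ u + (1 - x - e₁) * (1 - x - f₂) * (1 - x) ^ u) *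
        (x ^ (w + 1) / 2 *
          ((1 + x + e₃) * (1 + x + f₄) * (1 + x) ^ w +
            (1 - x - e₃) * (1 - x - f₄) * (1 - x) ^ w)) * (1 + x) ^ 4 := by ring

/-! ## The stub -/

/-- **Tool stub `stub_ladder_bottomRow_adjacent`.** On the ladder `{0..L}×{0,1}`, for bottom sites
`c₁ < c₂ < c₃ < c₄ ≤ L` and `0 ≤ x ≤ 1/2`: the crossing pairing weighs at most the ADJACENT one,
`Z₁₃ Z₂₄ ≤ Z₁₂ Z₃₄`. Mechanism: in the rank-two form of the bottom-row kernels
(`ladderAdj_kernel`) the crossing product carries the extra factor `(x(1+x))^{2(c₃-c₂)}` while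
the bracket ratios are at most `((1+x)² + (1-x)²)/(1+x)²` each, and
`(x(1+x))² ((1+x)²+(1-x)²)² ≤ (1+x)⁴` on `[0, 1/2]`; the end corrections `E_k` only help (`E` is
monotone in `k`). [folklore] -/
theorem stub_ladder_bottomRow_adjacent (L : ℕ) {c₁ c₂ c₃ c₄ : ℕ} (h₁₂ : c₁ < c₂) (h₂₃ : c₂ < c₃) (h₃₄ : c₃ < c₄)
    (h₄ : c₄ ≤ L) {x : ℝ} (hx0 : 0 ≤ x) (hx : x ≤ 1 / 2) :
    pathKernel (discreteDomainGraph (rectDomain L 1) 1) x (st c₁ 0) (st c₃ 0) *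
        pathKernel (discreteDomainGraph (rectDomain L 1) 1) x (st c₂ 0) (st c₄ 0) ≤
      pathKernel (discreteDomainGraph (rectDomain L 1) 1) x (st c₁ 0) (st c₂ 0) *
        pathKernel (discreteDomainGraph (rectDomain L 1) 1) x (st c₃ 0) (st c₄ 0) := by
  obtain ⟨u, hu⟩ : ∃ u, c₂ = c₁ + u + 1 := ⟨c₂ - c₁ - 1, by omega⟩
  obtain ⟨m, hm⟩ : ∃ m, c₃ = c₂ + m + 1 := ⟨c₃ - c₂ - 1, by omega⟩
  obtain ⟨w, hw⟩ : ∃ w, c₄ = c₃ + w + 1 := ⟨c₄ - c₃ - 1, by omega⟩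
  have hE := fun k => ladderAdj_E_nonneg hx0 k
  have hE' := fun k => ladderAdj_E_le hx0 hx k
  rw [ladderAdj_kernel L c₁ c₃ (u + m + 1) (by omega) (by omega) hx0,
    ladderAdj_kernel L c₂ c₄ (m + w + 1) (by omega) h₄ hx0,
    ladderAdj_kernel L c₁ c₂ u (by omega) (by omega) hx0,
    ladderAdj_kernel L c₃ c₄ w (by omega) h₄ hx0,
    ← ENNReal.ofReal_mul
      (ladderAdj_form_nonneg (u + m + 1) hx0 hx (hE c₁) (hE' c₁) (hE (L - c₃)) (hE' (L - c₃))),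
    ← ENNReal.ofReal_mul (ladderAdj_form_nonneg u hx0 hx (hE c₁) (hE' c₁) (hE (L - c₂)) (hE' (L - c₂)))]
  exact ENNReal.ofReal_le_ofReal (ladderAdj_real u m w hx0 hx (hE c₁) (hE' c₁) (hE c₂) (hE' c₂)
    (hE c₃) (hE' c₃) (hE (L - c₂)) (hE' (L - c₂)) (hE (L - c₃)) (hE' (L - c₃)) (hE (L - c₄))
    (hE' (L - c₄)) (ladderAdj_E_mono hx0 (by omega : c₂ ≤ c₃))
    (ladderAdj_E_mono hx0 (by omega : L - c₃ ≤ L - c₂)))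

end Summit.CriticalPhenomena.SAWScalingLimit.Theorems.BoundaryTP2
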